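/-
Copyright (c) 2026 the pub-hodgecm-mathlib formalisation cell (harness21).  Prover seat hodgecm-mathlib-LH5-p02 (g2): line LH4 (Shalika pay-down), organ ‹RAO› ∕ RAO-CONV,
brick «BALL-INDEX GROWTH» for RAO-REG MAIN (LH4-plan (g2) DEAL 2026-09-02T04:37:37Z); 2026-09-02.
-/
import Literature.NumberTheory.Automorphic.SubgroupIndexDevissage     -- ★ (lit-hodgefound-p11 g45): `map_mulLeft_leAddSubgroup`, `relIndex_leAddSubgroup_exp_ne_zero` (the balls of a `ℤᵐ⁰`-valued field are commensurable)
import HarnessLib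

/-!
# Valuation balls of a stable additive subgroup: commensurability, scaling, and GEOMETRIC GROWTH of the index `[B(n) ∩ F : B(m) ∩ F] ≥ 2^k`
(Ranga Rao, Ann. of Math. 96 (1972) — the lattice count behind the convergence of the REGULAR unipotent orbital integral, done WITHOUT residue-field
cardinalities; Serre, *Corps locaux* II §3; Weil, *Basic Number Theory* I §4)

Topic `NumberTheory/Automorphic`; namespace `Literature.NumberTheory.Automorphic`.  THEOREMS ONLY (no definition, no instance, no notation, no named fact, no `sorry`);
kernel lane `--supports stmt-HodgeConjecture-24833`.  Cell `pub/hodgecm-mathlib` (D-0151), crux H413 = `stmt-HodgeConjecture-24833`; half A line LH4 (Shalika pay-down of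
the print row `stub_N6nsShalika`), organ ‹RAO›, brick RAO-CONV «Regular» (memo `RAO-CONV.census.F0P3ap09g4` §2 (III)): the COUNT of the level-`j` shells of a regular
unipotent orbit of `U(3)` against the growth of the level-`j` compact open subgroups of its centraliser is a RATIO of indices of valuation balls inside the fixed line
`F = (L_w)^{σ}` (resp. the skew line `ξ·F`), and all the consumer needs is that this ratio decays geometrically.  This file proves that for ANY additive subgroup `F` of a
`ℤᵐ⁰`-valued field `K` (finite residue field, a uniformiser) which is stable under multiplication by `c^{±1}` for some `c` with `v c = exp(−d)`, `d > 0`, and contains `1`: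
the balls `B_F(n) := {v ≤ exp n} ⊓ F` are commensurable, their indices are invariant under the shift `n ↦ n + d` and multiplicative, and `[B_F(m + dk) : B_F(m)] ≥ 2^k` —
no residue-field cardinality, no ramification index, the same proof at inert and ramified places (the consumer takes `K = L_w`, `F = (L_w)^{σ_w}`, `c = N(ϖ_w) = ϖ_w σ_w(ϖ_w)`, `d = 2`).
HONEST LABEL: HC_CM is proved only modulo the 7 printed citations (2 remaining named inputs: hLiu418 = stmt-HodgeConjecture-24832, h413 = stmt-HodgeConjecture-24833) until
rung 0 closes; count-neutral brick (pure valuation∕index algebra).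

* §1 `leAddSubgroup_inf_mono`, **`relIndex_leAddSubgroup_inf_ne_zero`** (commensurability, from ★ `relIndex_leAddSubgroup_exp_ne_zero` for the full balls).
* §2 **`relIndex_leAddSubgroup_inf_shift`** (`[B_F(n+d) : B_F(m+d)] = [B_F(n) : B_F(m)]`, transport along `x ↦ c⁻¹x`), `…_shift_mul` (by `d·t`, `t ∈ ℤ`), and the companion
  **`relIndex_leAddSubgroup_inf_eq_of_forall_mem_iff`** (transport along `x ↦ ξx` between two subgroups `F`, `F′ = ξF`: `[B_{F′}(n+e) : B_{F′}(m+e)] = [B_F(n) : B_F(m)]`, `v ξ = exp e` —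
  the skew line `ξ·F` of an involution against its fixed line `F`).
* §3 **`two_le_relIndex_leAddSubgroup_inf`** (`[B_F(r+d) : B_F(r)] ≥ 2` for `0 ≤ r < d`: `c⁻¹` is a witness of strictness) and **`pow_two_le_relIndex_leAddSubgroup_inf`**
  (`2^k ≤ [B_F(m + dk) : B_F(m)]`, all `m`).
* §4 **`relIndex_mul_pow_two_le`** — the consumer inequality for `d = 2`: with `j₀ ≤ 0 ≤ r`, `j₀ ≤ j`, `−r ≤ j`, `k = ⌊(j − 2j₀)∕2⌋`:
  `[B_F(r+2j−e) : B_F(j−e)] · 2^k ≤ [B_F(r+2j₀−e) : B_F(2j₀−e)] · [B_F(2j−e) : B_F(2j₀−e)]` — «the number of level-`j` shells times `2^{⌊j∕2⌋}` is at most a constant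
  times the growth of the level-`j` centraliser ball» (memo (III) «Regular», `q`-free form).

## References
* [Rao1972] R. Ranga Rao, *Orbital integrals in reductive groups*, Ann. of Math. (2) 96 (1972) 505–510 (the lattice count in the proof of the Theorem).
* [Serre1979] J.-P. Serre, *Local Fields*, GTM 67 (1979), Ch. II §3 (the filtration `𝔪^n` and its indices).
* [WeilBNT1967] A. Weil, *Basic Number Theory*, Grundlehren 144 (1967), Ch. I §4 (the module of an automorphism `x ↦ cx` of a local field).
-/

set_option autoImplicit false

open scoped Valued WithZero

namespace Literature.NumberTheory.Automorphic

variable {K : Type*} [Field K] [Valued K ℤᵐ⁰] (F : AddSubgroup K)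

/-! ## §1 The balls `B_F(n) = {v ≤ exp n} ⊓ F`: monotone and commensurable -/

/-- `B_F(m) ≤ B_F(n)` for `m ≤ n`. [cite: Serre1979, Ch. II §3] -/
theorem leAddSubgroup_inf_mono {m n : ℤ} (h : m ≤ n) :
    (Valued.v : Valuation K ℤᵐ⁰).leAddSubgroup (WithZero.exp m) ⊓ F ≤ (Valued.v : Valuation K ℤᵐ⁰).leAddSubgroup (WithZero.exp n) ⊓ F :=
  inf_le_inf_right F (Valuation.leAddSubgroup_monotone _ (WithZero.exp_le_exp.2 h))

/-- **COMMENSURABILITY**: `[B_F(n) : B_F(m)] ≠ 0` for all `m, n` (the index in `F` is at most the index `[{v ≤ exp n} : {v ≤ exp m}]` of the full balls, which is a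
power of the finite residue-field cardinality, ★ `relIndex_leAddSubgroup_exp_ne_zero`). [cite: Serre1979, Ch. II §3, Prop. 5] -/
theorem relIndex_leAddSubgroup_inf_ne_zero {ϖ : K} (hϖ : Valued.v ϖ = WithZero.exp (-1 : ℤ)) [Finite 𝓀[K]] (m n : ℤ) :
    ((Valued.v : Valuation K ℤᵐ⁰).leAddSubgroup (WithZero.exp m) ⊓ F).relIndex ((Valued.v : Valuation K ℤᵐ⁰).leAddSubgroup (WithZero.exp n) ⊓ F) ≠ 0 := by
  have h0 := relIndex_leAddSubgroup_exp_ne_zero hϖ n m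
  -- `[{v ≤ exp n} ⊓ F : {v ≤ exp m} ∩ _] ≠ 0` (a smaller ambient group has a smaller index)
  have h1 : ((Valued.v : Valuation K ℤᵐ⁰).leAddSubgroup (WithZero.exp m)).relIndex
      ((Valued.v : Valuation K ℤᵐ⁰).leAddSubgroup (WithZero.exp n) ⊓ F) ≠ 0 :=
    fun h => h0 (AddSubgroup.relIndex_eq_zero_of_le_right inf_le_left h)
  -- `({v ≤ m} ⊓ F) ⊓ ({v ≤ n} ⊓ F) = {v ≤ m} ⊓ ({v ≤ n} ⊓ F)`: both relative indices are indices of the same subgroup of `{v ≤ n} ⊓ F`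
  have hinf : ((Valued.v : Valuation K ℤᵐ⁰).leAddSubgroup (WithZero.exp m) ⊓ F) ⊓ ((Valued.v : Valuation K ℤᵐ⁰).leAddSubgroup (WithZero.exp n) ⊓ F) =
      (Valued.v : Valuation K ℤᵐ⁰).leAddSubgroup (WithZero.exp m) ⊓ ((Valued.v : Valuation K ℤᵐ⁰).leAddSubgroup (WithZero.exp n) ⊓ F) := by
    ext x
    simp only [AddSubgroup.mem_inf]
    tauto
  rw [← AddSubgroup.inf_relIndex_right, hinf, AddSubgroup.inf_relIndex_right]
  exact h1

/-! ## §2 Shifting and transporting the balls -/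

/-- **SCALING**: if `v c = exp(−d)` and `F` is stable under `x ↦ c x` and `x ↦ c⁻¹ x`, then `x ↦ c⁻¹x` carries `B_F(k)` onto `B_F(k+d)`. [cite: WeilBNT1967, Ch. I §4] -/
theorem map_mulLeft_inv_leAddSubgroup_inf {c : K} {d : ℤ} (hc : Valued.v c = WithZero.exp (-d))
    (hcF : ∀ x ∈ F, c * x ∈ F) (hcF' : ∀ x ∈ F, c⁻¹ * x ∈ F) (k : ℤ) :
    ((Valued.v : Valuation K ℤᵐ⁰).leAddSubgroup (WithZero.exp k) ⊓ F).map (AddMonoidHom.mulLeft c⁻¹) =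
      (Valued.v : Valuation K ℤᵐ⁰).leAddSubgroup (WithZero.exp (k + d)) ⊓ F := by
  have hc0 : c ≠ 0 := fun h => by rw [h, map_zero] at hc; exact WithZero.coe_ne_zero hc.symm
  have hci : Valued.v c⁻¹ = WithZero.exp d := by rw [map_inv₀, hc, ← WithZero.exp_neg, neg_neg]
  ext y
  simp only [AddSubgroup.mem_map, AddSubgroup.mem_inf, Valuation.mem_leAddSubgroup_iff, AddMonoidHom.coe_mulLeft]
  constructor
  · rintro ⟨x, ⟨hx, hxF⟩, rfl⟩
    refine ⟨?_, hcF' x hxF⟩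
    rw [map_mul, hci, show WithZero.exp (k + d) = WithZero.exp d * WithZero.exp k by rw [WithZero.exp_add, mul_comm]]
    exact mul_le_mul_right hx _
  · rintro ⟨hy, hyF⟩
    refine ⟨c * y, ⟨?_, hcF y hyF⟩, by rw [inv_mul_cancel_left₀ hc0]⟩
    rw [map_mul, hc]
    calc WithZero.exp (-d) * Valued.v y ≤ WithZero.exp (-d) * WithZero.exp (k + d) := mul_le_mul_right hy _
      _ = WithZero.exp k := by rw [← WithZero.exp_add]; congr 1; omega

/-- **SHIFT INVARIANCE OF THE INDEX**: `[B_F(n+d) : B_F(m+d)] = [B_F(n) : B_F(m)]` (transport along the injective map `x ↦ c⁻¹x`). [cite: WeilBNT1967, Ch. I §4] -/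
theorem relIndex_leAddSubgroup_inf_shift {c : K} {d : ℤ} (hc : Valued.v c = WithZero.exp (-d))
    (hcF : ∀ x ∈ F, c * x ∈ F) (hcF' : ∀ x ∈ F, c⁻¹ * x ∈ F) (m n : ℤ) :
    ((Valued.v : Valuation K ℤᵐ⁰).leAddSubgroup (WithZero.exp (m + d)) ⊓ F).relIndex ((Valued.v : Valuation K ℤᵐ⁰).leAddSubgroup (WithZero.exp (n + d)) ⊓ F) =
      ((Valued.v : Valuation K ℤᵐ⁰).leAddSubgroup (WithZero.exp m) ⊓ F).relIndex ((Valued.v : Valuation K ℤᵐ⁰).leAddSubgroup (WithZero.exp n) ⊓ F) := by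
  have hc0 : c ≠ 0 := fun h => by rw [h, map_zero] at hc; exact WithZero.coe_ne_zero hc.symm
  have hinj : Function.Injective (AddMonoidHom.mulLeft c⁻¹ : K →+ K) := mul_right_injective₀ (inv_ne_zero hc0)
  rw [← map_mulLeft_inv_leAddSubgroup_inf F hc hcF hcF' m, ← map_mulLeft_inv_leAddSubgroup_inf F hc hcF hcF' n,
    AddSubgroup.relIndex_map_map_of_injective _ _ hinj]

/-- Shift invariance by any multiple `d·t`, `t ∈ ℤ`. [cite: WeilBNT1967, Ch. I §4] -/
theorem relIndex_leAddSubgroup_inf_shift_mul {c : K} {d : ℤ} (hc : Valued.v c = WithZero.exp (-d))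
    (hcF : ∀ x ∈ F, c * x ∈ F) (hcF' : ∀ x ∈ F, c⁻¹ * x ∈ F) (m n t : ℤ) :
    ((Valued.v : Valuation K ℤᵐ⁰).leAddSubgroup (WithZero.exp (m + d * t)) ⊓ F).relIndex ((Valued.v : Valuation K ℤᵐ⁰).leAddSubgroup (WithZero.exp (n + d * t)) ⊓ F) =
      ((Valued.v : Valuation K ℤᵐ⁰).leAddSubgroup (WithZero.exp m) ⊓ F).relIndex ((Valued.v : Valuation K ℤᵐ⁰).leAddSubgroup (WithZero.exp n) ⊓ F) := by
  induction t using Int.induction_on with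
  | zero => simp only [mul_zero, add_zero]
  | succ i ih =>
    rw [← ih, show m + d * ((i : ℤ) + 1) = (m + d * i) + d by ring, show n + d * ((i : ℤ) + 1) = (n + d * i) + d by ring]
    exact relIndex_leAddSubgroup_inf_shift F hc hcF hcF' _ _
  | pred i ih =>
    rw [← ih, show m + d * (-(i : ℤ)) = (m + d * (-(i : ℤ) - 1)) + d by ring, show n + d * (-(i : ℤ)) = (n + d * (-(i : ℤ) - 1)) + d by ring]
    exact (relIndex_leAddSubgroup_inf_shift F hc hcF hcF' _ _).symm

/-- **TRANSPORT BETWEEN TWO LINES**: if `v ξ = exp e` and `x ↦ ξ x` maps `F` onto `F′` (`y ∈ F′ ↔ ξ⁻¹ y ∈ F`), then `[B_{F′}(n+e) : B_{F′}(m+e)] = [B_F(n) : B_F(m)]` (used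
with `F` the fixed line of an involution `σ` and `F′ = ξ·F` its skew line, `σξ = −ξ`). [cite: WeilBNT1967, Ch. I §4] -/
theorem relIndex_leAddSubgroup_inf_eq_of_forall_mem_iff (F' : AddSubgroup K) {ξ : K} {e : ℤ} (hξ : Valued.v ξ = WithZero.exp e)
    (hFF' : ∀ y, y ∈ F' ↔ ξ⁻¹ * y ∈ F) (m n : ℤ) :
    ((Valued.v : Valuation K ℤᵐ⁰).leAddSubgroup (WithZero.exp (m + e)) ⊓ F').relIndex ((Valued.v : Valuation K ℤᵐ⁰).leAddSubgroup (WithZero.exp (n + e)) ⊓ F') =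
      ((Valued.v : Valuation K ℤᵐ⁰).leAddSubgroup (WithZero.exp m) ⊓ F).relIndex ((Valued.v : Valuation K ℤᵐ⁰).leAddSubgroup (WithZero.exp n) ⊓ F) := by
  have hξ0 : ξ ≠ 0 := fun h => by rw [h, map_zero] at hξ; exact WithZero.coe_ne_zero hξ.symm
  have hinj : Function.Injective (AddMonoidHom.mulLeft ξ : K →+ K) := mul_right_injective₀ hξ0
  have hmap : ∀ k : ℤ, ((Valued.v : Valuation K ℤᵐ⁰).leAddSubgroup (WithZero.exp k) ⊓ F).map (AddMonoidHom.mulLeft ξ) =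
      (Valued.v : Valuation K ℤᵐ⁰).leAddSubgroup (WithZero.exp (k + e)) ⊓ F' := by
    intro k
    ext y
    simp only [AddSubgroup.mem_map, AddSubgroup.mem_inf, Valuation.mem_leAddSubgroup_iff, AddMonoidHom.coe_mulLeft]
    constructor
    · rintro ⟨x, ⟨hx, hxF⟩, rfl⟩
      refine ⟨?_, (hFF' _).2 (by rwa [inv_mul_cancel_left₀ hξ0])⟩
      rw [map_mul, hξ, show WithZero.exp (k + e) = WithZero.exp e * WithZero.exp k by rw [WithZero.exp_add, mul_comm]]
      exact mul_le_mul_right hx _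
    · rintro ⟨hy, hyF'⟩
      refine ⟨ξ⁻¹ * y, ⟨?_, (hFF' y).1 hyF'⟩, by rw [mul_inv_cancel_left₀ hξ0]⟩
      rw [map_mul, map_inv₀, hξ, ← WithZero.exp_neg]
      calc WithZero.exp (-e) * Valued.v y ≤ WithZero.exp (-e) * WithZero.exp (k + e) := mul_le_mul_right hy _
        _ = WithZero.exp k := by rw [← WithZero.exp_add]; congr 1; omega
  rw [← hmap m, ← hmap n, AddSubgroup.relIndex_map_map_of_injective _ _ hinj]

/-! ## §3 Strictness: the index of one step is at least `2`, of `k` steps at least `2^k` -/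

/-- **ONE STEP COSTS AT LEAST `2`**: for `0 ≤ r < d`, `[B_F(r+d) : B_F(r)] ≥ 2` — `c⁻¹ ∈ B_F(r+d) ∖ B_F(r)` (`v c⁻¹ = exp d`, `c⁻¹ = c⁻¹·1 ∈ F`), and the index is
finite (§1). [cite: Rao1972, Theorem] [cite: Serre1979, Ch. II §3] -/
theorem two_le_relIndex_leAddSubgroup_inf {ϖ : K} (hϖ : Valued.v ϖ = WithZero.exp (-1 : ℤ)) [Finite 𝓀[K]]
    {c : K} {d : ℤ} (hc : Valued.v c = WithZero.exp (-d)) (hcF' : ∀ x ∈ F, c⁻¹ * x ∈ F) (h1 : (1 : K) ∈ F)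
    {r : ℤ} (hr0 : 0 ≤ r) (hrd : r < d) :
    2 ≤ ((Valued.v : Valuation K ℤᵐ⁰).leAddSubgroup (WithZero.exp r) ⊓ F).relIndex ((Valued.v : Valuation K ℤᵐ⁰).leAddSubgroup (WithZero.exp (r + d)) ⊓ F) := by
  have hne0 := relIndex_leAddSubgroup_inf_ne_zero F hϖ r (r + d)
  have hci : Valued.v c⁻¹ = WithZero.exp d := by rw [map_inv₀, hc, ← WithZero.exp_neg, neg_neg]
  -- `c⁻¹ ∈ B_F(r+d) ∖ B_F(r)`, so `B_F(r+d) ≰ B_F(r)` and the index is not `1`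
  have hmem : c⁻¹ ∈ (Valued.v : Valuation K ℤᵐ⁰).leAddSubgroup (WithZero.exp (r + d)) ⊓ F := by
    refine AddSubgroup.mem_inf.2 ⟨?_, by simpa using hcF' 1 h1⟩
    rw [Valuation.mem_leAddSubgroup_iff, hci]
    exact WithZero.exp_le_exp.2 (by omega)
  have hnot : c⁻¹ ∉ (Valued.v : Valuation K ℤᵐ⁰).leAddSubgroup (WithZero.exp r) ⊓ F := by
    intro h
    have h' := (AddSubgroup.mem_inf.1 h).1
    rw [Valuation.mem_leAddSubgroup_iff, hci, WithZero.exp_le_exp] at h'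
    omega
  have hne1 : ((Valued.v : Valuation K ℤᵐ⁰).leAddSubgroup (WithZero.exp r) ⊓ F).relIndex
      ((Valued.v : Valuation K ℤᵐ⁰).leAddSubgroup (WithZero.exp (r + d)) ⊓ F) ≠ 1 := by
    rw [Ne, AddSubgroup.relIndex_eq_one]
    exact fun hle => hnot (hle hmem)
  omega

/-- **`k` STEPS COST AT LEAST `2^k`**: `2^k ≤ [B_F(m + dk) : B_F(m)]` for every `m` (multiplicativity of the index along `B_F(m) ≤ B_F(m+d) ≤ ⋯`, each step shifted into
the window `0 ≤ r < d` of `two_le_relIndex_leAddSubgroup_inf` by §2). [cite: Rao1972, Theorem] [cite: Serre1979, Ch. II §3] -/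
theorem pow_two_le_relIndex_leAddSubgroup_inf {ϖ : K} (hϖ : Valued.v ϖ = WithZero.exp (-1 : ℤ)) [Finite 𝓀[K]]
    {c : K} {d : ℤ} (hd : 0 < d) (hc : Valued.v c = WithZero.exp (-d)) (hcF : ∀ x ∈ F, c * x ∈ F) (hcF' : ∀ x ∈ F, c⁻¹ * x ∈ F) (h1 : (1 : K) ∈ F)
    (m : ℤ) (k : ℕ) :
    2 ^ k ≤ ((Valued.v : Valuation K ℤᵐ⁰).leAddSubgroup (WithZero.exp m) ⊓ F).relIndex ((Valued.v : Valuation K ℤᵐ⁰).leAddSubgroup (WithZero.exp (m + d * k)) ⊓ F) := by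
  induction k with
  | zero => rw [pow_zero, Nat.cast_zero, mul_zero, add_zero, AddSubgroup.relIndex_self]
  | succ k ih =>
    -- `[B(m + d(k+1)) : B(m)] = [B(m + dk) : B(m)] · [B(m + dk + d) : B(m + dk)]`
    have hle1 : (Valued.v : Valuation K ℤᵐ⁰).leAddSubgroup (WithZero.exp m) ⊓ F ≤ (Valued.v : Valuation K ℤᵐ⁰).leAddSubgroup (WithZero.exp (m + d * k)) ⊓ F :=
      leAddSubgroup_inf_mono F (by nlinarith)
    have hle2 : (Valued.v : Valuation K ℤᵐ⁰).leAddSubgroup (WithZero.exp (m + d * k)) ⊓ F ≤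
        (Valued.v : Valuation K ℤᵐ⁰).leAddSubgroup (WithZero.exp (m + d * ↑(k + 1))) ⊓ F :=
      leAddSubgroup_inf_mono F (by push_cast; nlinarith)
    rw [← AddSubgroup.relIndex_mul_relIndex _ _ _ hle1 hle2, pow_succ]
    refine Nat.mul_le_mul ih ?_
    -- shift the last step into the window `[0, d)`: `m + dk = r + d·t`, `0 ≤ r < d`
    obtain ⟨t, r, hr0, hrd, hmk⟩ : ∃ t r : ℤ, 0 ≤ r ∧ r < d ∧ m + d * k = r + d * t :=
      ⟨(m + d * k) / d, (m + d * k) % d, Int.emod_nonneg _ hd.ne', Int.emod_lt_of_pos _ hd, by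
        have h := Int.mul_ediv_add_emod (m + d * k) d; linarith⟩
    rw [show m + d * ↑(k + 1) = (r + d) + d * t by push_cast; linear_combination hmk, hmk,
      relIndex_leAddSubgroup_inf_shift_mul F hc hcF hcF' r (r + d) t]
    exact two_le_relIndex_leAddSubgroup_inf F hϖ hc hcF' h1 hr0 hrd

/-! ## §4 The consumer inequality (`d = 2`): shells against centraliser growth -/

/-- **SHELL COUNT AGAINST CENTRALISER GROWTH** (`d = 2`, the module of `c = N(ϖ_w)` on the fixed line): for integers `e`, `r ≥ 0`, `j₀ ≤ 0`, `j ≥ j₀`, `j ≥ −r`, with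
`k = ⌊(j − 2j₀)∕2⌋`,
`[B_F(r+2j−e) : B_F(j−e)] · 2^k ≤ [B_F(r+2j₀−e) : B_F(2j₀−e)] · [B_F(2j−e) : B_F(2j₀−e)]`.
PROOF: `[B(r+2j−e) : B(j−e)]·[B(j−e) : B(2j₀−e)] = [B(r+2j−e) : B(2j₀−e)] = [B(r+2j−e) : B(2j−e)]·[B(2j−e) : B(2j₀−e)]`, the first factor on the right is the constant
`[B(r+2j₀−e) : B(2j₀−e)]` by the shift `2(j − j₀)` (§2), and `[B(j−e) : B(2j₀−e)] ≥ [B(2j₀−e+2k) : B(2j₀−e)] ≥ 2^k` (§3).  In the consumer: `#(level-j shells) · 2^{⌊j∕2⌋−j₀}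
≤ const · [S_j : S_{j₀}]`, so `μ(level j) ≲ 2^{−j∕2}`. [cite: Rao1972, Theorem] [cite: Serre1979, Ch. II §3] -/
theorem relIndex_mul_pow_two_le {ϖ : K} (hϖ : Valued.v ϖ = WithZero.exp (-1 : ℤ)) [Finite 𝓀[K]]
    {c : K} (hc : Valued.v c = WithZero.exp (-2 : ℤ)) (hcF : ∀ x ∈ F, c * x ∈ F) (hcF' : ∀ x ∈ F, c⁻¹ * x ∈ F) (h1 : (1 : K) ∈ F)
    (e : ℤ) {r j₀ j : ℤ} (hr : 0 ≤ r) (hj₀ : j₀ ≤ 0) (hj : j₀ ≤ j) (hjr : -r ≤ j) :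
    ((Valued.v : Valuation K ℤᵐ⁰).leAddSubgroup (WithZero.exp (j - e)) ⊓ F).relIndex ((Valued.v : Valuation K ℤᵐ⁰).leAddSubgroup (WithZero.exp (r + 2 * j - e)) ⊓ F) *
        2 ^ ((j - 2 * j₀) / 2).toNat ≤
      ((Valued.v : Valuation K ℤᵐ⁰).leAddSubgroup (WithZero.exp (2 * j₀ - e)) ⊓ F).relIndex ((Valued.v : Valuation K ℤᵐ⁰).leAddSubgroup (WithZero.exp (r + 2 * j₀ - e)) ⊓ F) *
        ((Valued.v : Valuation K ℤᵐ⁰).leAddSubgroup (WithZero.exp (2 * j₀ - e)) ⊓ F).relIndex ((Valued.v : Valuation K ℤᵐ⁰).leAddSubgroup (WithZero.exp (2 * j - e)) ⊓ F) := by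
  have hd : (0 : ℤ) < 2 := by norm_num
  -- the chain `B(2j₀−e) ≤ B(j−e) ≤ B(r+2j−e)` and `B(2j₀−e) ≤ B(2j−e) ≤ B(r+2j−e)`
  have h1le : (Valued.v : Valuation K ℤᵐ⁰).leAddSubgroup (WithZero.exp (2 * j₀ - e)) ⊓ F ≤ (Valued.v : Valuation K ℤᵐ⁰).leAddSubgroup (WithZero.exp (j - e)) ⊓ F :=
    leAddSubgroup_inf_mono F (by omega)
  have h2le : (Valued.v : Valuation K ℤᵐ⁰).leAddSubgroup (WithZero.exp (j - e)) ⊓ F ≤ (Valued.v : Valuation K ℤᵐ⁰).leAddSubgroup (WithZero.exp (r + 2 * j - e)) ⊓ F :=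
    leAddSubgroup_inf_mono F (by omega)
  have h3le : (Valued.v : Valuation K ℤᵐ⁰).leAddSubgroup (WithZero.exp (2 * j₀ - e)) ⊓ F ≤ (Valued.v : Valuation K ℤᵐ⁰).leAddSubgroup (WithZero.exp (2 * j - e)) ⊓ F :=
    leAddSubgroup_inf_mono F (by omega)
  have h4le : (Valued.v : Valuation K ℤᵐ⁰).leAddSubgroup (WithZero.exp (2 * j - e)) ⊓ F ≤ (Valued.v : Valuation K ℤᵐ⁰).leAddSubgroup (WithZero.exp (r + 2 * j - e)) ⊓ F :=
    leAddSubgroup_inf_mono F (by omega)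
  -- (1)+(2): `[B(r+2j−e) : B(j−e)]·[B(j−e) : B(2j₀−e)] = [B(2j−e) : B(2j₀−e)]·[B(r+2j−e) : B(2j−e)]`
  have h12 := (AddSubgroup.relIndex_mul_relIndex _ _ _ h1le h2le).trans (AddSubgroup.relIndex_mul_relIndex _ _ _ h3le h4le).symm
  -- (3): `[B(r+2j−e) : B(2j−e)] = [B(r+2j₀−e) : B(2j₀−e)]` (shift by `2(j − j₀)`)
  have h3 : ((Valued.v : Valuation K ℤᵐ⁰).leAddSubgroup (WithZero.exp (2 * j - e)) ⊓ F).relIndex ((Valued.v : Valuation K ℤᵐ⁰).leAddSubgroup (WithZero.exp (r + 2 * j - e)) ⊓ F) =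
      ((Valued.v : Valuation K ℤᵐ⁰).leAddSubgroup (WithZero.exp (2 * j₀ - e)) ⊓ F).relIndex ((Valued.v : Valuation K ℤᵐ⁰).leAddSubgroup (WithZero.exp (r + 2 * j₀ - e)) ⊓ F) := by
    rw [show 2 * j - e = (2 * j₀ - e) + 2 * (j - j₀) by ring, show r + 2 * j - e = (r + 2 * j₀ - e) + 2 * (j - j₀) by ring,
      relIndex_leAddSubgroup_inf_shift_mul F hc hcF hcF' _ _ (j - j₀)]
  -- (4): `2^k ≤ [B(2j₀−e+2k) : B(2j₀−e)] ≤ [B(j−e) : B(2j₀−e)]`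
  have hk : 2 * (((j - 2 * j₀) / 2).toNat : ℤ) ≤ j - 2 * j₀ := by
    rw [Int.toNat_of_nonneg (Int.ediv_nonneg (by omega) (by norm_num))]
    have h₁ := Int.mul_ediv_add_emod (j - 2 * j₀) 2
    have h₂ := Int.emod_nonneg (j - 2 * j₀) (two_ne_zero)
    linarith
  have h4 : 2 ^ ((j - 2 * j₀) / 2).toNat ≤ ((Valued.v : Valuation K ℤᵐ⁰).leAddSubgroup (WithZero.exp (2 * j₀ - e)) ⊓ F).relIndex
      ((Valued.v : Valuation K ℤᵐ⁰).leAddSubgroup (WithZero.exp (j - e)) ⊓ F) := by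
    refine (pow_two_le_relIndex_leAddSubgroup_inf F hϖ hd hc hcF hcF' h1 (2 * j₀ - e) ((j - 2 * j₀) / 2).toNat).trans ?_
    refine AddSubgroup.relIndex_le_of_le_right (leAddSubgroup_inf_mono F (by omega)) ?_
    exact relIndex_leAddSubgroup_inf_ne_zero F hϖ _ _
  -- assemble
  calc ((Valued.v : Valuation K ℤᵐ⁰).leAddSubgroup (WithZero.exp (j - e)) ⊓ F).relIndex ((Valued.v : Valuation K ℤᵐ⁰).leAddSubgroup (WithZero.exp (r + 2 * j - e)) ⊓ F) *
          2 ^ ((j - 2 * j₀) / 2).toNat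
        ≤ ((Valued.v : Valuation K ℤᵐ⁰).leAddSubgroup (WithZero.exp (j - e)) ⊓ F).relIndex ((Valued.v : Valuation K ℤᵐ⁰).leAddSubgroup (WithZero.exp (r + 2 * j - e)) ⊓ F) *
          ((Valued.v : Valuation K ℤᵐ⁰).leAddSubgroup (WithZero.exp (2 * j₀ - e)) ⊓ F).relIndex ((Valued.v : Valuation K ℤᵐ⁰).leAddSubgroup (WithZero.exp (j - e)) ⊓ F) :=
          Nat.mul_le_mul_left _ h4
    _ = ((Valued.v : Valuation K ℤᵐ⁰).leAddSubgroup (WithZero.exp (2 * j₀ - e)) ⊓ F).relIndex ((Valued.v : Valuation K ℤᵐ⁰).leAddSubgroup (WithZero.exp (j - e)) ⊓ F) *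
          ((Valued.v : Valuation K ℤᵐ⁰).leAddSubgroup (WithZero.exp (j - e)) ⊓ F).relIndex ((Valued.v : Valuation K ℤᵐ⁰).leAddSubgroup (WithZero.exp (r + 2 * j - e)) ⊓ F) :=
          Nat.mul_comm _ _
    _ = ((Valued.v : Valuation K ℤᵐ⁰).leAddSubgroup (WithZero.exp (2 * j₀ - e)) ⊓ F).relIndex ((Valued.v : Valuation K ℤᵐ⁰).leAddSubgroup (WithZero.exp (2 * j - e)) ⊓ F) *
          ((Valued.v : Valuation K ℤᵐ⁰).leAddSubgroup (WithZero.exp (2 * j - e)) ⊓ F).relIndex ((Valued.v : Valuation K ℤᵐ⁰).leAddSubgroup (WithZero.exp (r + 2 * j - e)) ⊓ F) := h12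
    _ = _ := by rw [h3, Nat.mul_comm]

end Literature.NumberTheory.Automorphic
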